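import Summits.ValiantsHypothesis.ValiantsHypothesis.Theorems.SymPencilPerFourHessianMinors
import Mathlib.LinearAlgebra.Matrix.ToLinearEquiv

/-!
# Route `SymPencil` — the eight-cell row pairing of `Hess per_4` and its discriminant
# (towards the case `(r, dim V) = (9, 7)` at defects `6, 7`, i.e. sizes `m = 25, 26`;
# `--supports` stmt-ValiantsHypothesis-5674 `SdcSuperquadratic`; rung currency only)

For a `4 × 4` matrix `y` and a base point `u` supported on the two rows `2, 3` (`u_{2j} = v_j`,
`u_{3j} = w_j`, eight cells) the permanent `per_4 (u + s y)` has no constant and no linear term in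
`s`, and its `s²`-coefficient is the ROW PAIRING

  `Φ_y(v, w) = Σ_{j<l} P_{jl}(y) (v_j w_l + v_l w_j)`,  `P_{jl}(y) = y_{0j'} y_{1l'} + y_{0l'} y_{1j'}`
  (`{j', l'} = {j, l}ᶜ`),

the permanent of the matrix with rows `y_0, y_1, v, w` (`eval_perPoly_rowsTwoThree_add_smul`).
Only rows `0, 1` of `y` enter.  The `4 × 4` symmetric zero-diagonal matrix `P(y)` has the closed
determinant (matrix-determinant lemma on `αβᵀ + βαᵀ - 2 diag(α ∘ β)`, same matching products)

  `det P = -4 (A·B - 4 Π)`,  `A = Σ_j α_j Π_{i≠j} β_i`,  `B = Σ_j β_j Π_{i≠j} α_i`,  `Π = Π_i α_i β_i`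

(`α = y_0`, `β = y_1`; `det_pairing_eq`).  Consequently (`pairingDisc_eq_of_sum_sq_swap_rows01`,
`pairingDisc_eq_of_sum_sq_swap`): if `y` has the SWAPPED property with `|ι| < 8` squares — the
`s²`-coefficient of `per_4 (u + s y)` is `Σ_k c_k Λ_k(u)²` for all `u`, i.e.
`rank (Hess per_4)(y) ≤ 7` — then the eight-variable form `Φ_y` is degenerate, `P(y)` is
singular, and `A·B = 4 Π` for the two rows `p ≠ q` of `y` complementary to the support of `u`.

This is the `d ≤ 7` successor of the `6 × 6` minors of `SymPencilPerFourHessianMinors`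
(val-width-5674-p2, `d ≤ 5`); it is sharp (`d = 8` is attained on two-row blocks).  It is used
in `SymPencilPerFourLowRankSevenDet` to exclude `7`-dimensional singular subspaces with
`rank Hess ≤ 7`.  Honest framing: a lemma; `sdc(per_4) ≥ 25` is the tree's value; the crux
`SdcSuperquadratic` and `VP ≠ VNP` are untouched.  No definitions, no named facts. [folklore]
-/

noncomputable section

-- single-conjunct layout: Sub = Summit, duplicated namespace component intended
set_option linter.dupNamespace false

namespace Summit.ValiantsHypothesis.ValiantsHypothesis.Theorems.SymPencilPerFourRowPairing

open Matrix MvPolynomial Finset Module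
open Literature.Computability.AlgebraicComplexity
open Summit.ValiantsHypothesis.ValiantsHypothesis.Theorems.SymPencilPerFourBlocks
open Summit.ValiantsHypothesis.ValiantsHypothesis.Theorems.SymPencilPerFourHessianBlocks
open Summit.ValiantsHypothesis.ValiantsHypothesis.Theorems.SymPencilPerFourHessianMinors

variable {K : Type*} [Field K]

/-! ### The discriminant of the row pairing -/

/-- **The discriminant of the row pairing.**  For `α, β : K⁴` let `P` be the symmetric
zero-diagonal `4 × 4` matrix with `P_{jl} = α_{j'} β_{l'} + α_{l'} β_{j'}`, `{j', l'} = {j, l}ᶜ`.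
Then `det P = -4 (A·B - 4 Π)` with `A = Σ_j α_j Π_{i≠j} β_i`, `B = Σ_j β_j Π_{i≠j} α_i`,
`Π = Π_i α_i β_i`. [folklore] -/
theorem det_pairing_eq (α β : Fin 4 → K) :
    (Matrix.of ![![0, α 2 * β 3 + α 3 * β 2, α 1 * β 3 + α 3 * β 1, α 1 * β 2 + α 2 * β 1],
                 ![α 2 * β 3 + α 3 * β 2, 0, α 0 * β 3 + α 3 * β 0, α 0 * β 2 + α 2 * β 0],
                 ![α 1 * β 3 + α 3 * β 1, α 0 * β 3 + α 3 * β 0, 0, α 0 * β 1 + α 1 * β 0],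
                 ![α 1 * β 2 + α 2 * β 1, α 0 * β 2 + α 2 * β 0, α 0 * β 1 + α 1 * β 0, 0]] :
        Matrix (Fin 4) (Fin 4) K).det =
      -4 * ((∑ j, ∏ i, if i = j then α i else β i) * (∑ j, ∏ i, if i = j then β i else α i) -
        4 * ∏ i, α i * β i) := by
  -- Laplace expansion along the first row (the `4 × 4` formula is `Matrix.det_fin_four` of
  -- `Literature.Geometry.Riemannian.TwistorFrameChange`; expanded here to keep the imports light)
  have s1 : Fin.succ (0 : Fin 3) = (1 : Fin 4) := by decide
  have s2 : Fin.succ (1 : Fin 3) = (2 : Fin 4) := by decide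
  have s3 : Fin.succ (2 : Fin 3) = (3 : Fin 4) := by decide
  have a00 : (0 : Fin 4).succAbove (0 : Fin 3) = 1 := by decide
  have a01 : (0 : Fin 4).succAbove (1 : Fin 3) = 2 := by decide
  have a02 : (0 : Fin 4).succAbove (2 : Fin 3) = 3 := by decide
  have a10 : (1 : Fin 4).succAbove (0 : Fin 3) = 0 := by decide
  have a11 : (1 : Fin 4).succAbove (1 : Fin 3) = 2 := by decide
  have a12 : (1 : Fin 4).succAbove (2 : Fin 3) = 3 := by decide
  have a20 : (2 : Fin 4).succAbove (0 : Fin 3) = 0 := by decide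
  have a21 : (2 : Fin 4).succAbove (1 : Fin 3) = 1 := by decide
  have a22 : (2 : Fin 4).succAbove (2 : Fin 3) = 3 := by decide
  have a30 : (3 : Fin 4).succAbove (0 : Fin 3) = 0 := by decide
  have a31 : (3 : Fin 4).succAbove (1 : Fin 3) = 1 := by decide
  have a32 : (3 : Fin 4).succAbove (2 : Fin 3) = 2 := by decide
  have v3 : ((3 : Fin 4) : ℕ) = 3 := rfl
  rw [Matrix.det_succ_row_zero, Fin.sum_univ_four]
  simp only [Matrix.det_fin_three, Matrix.submatrix_apply, s1, s2, s3, a00, a01, a02, a10, a11,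
    a12, a20, a21, a22, a30, a31, a32, Fin.val_zero, Fin.val_one, Fin.val_two, v3, pow_zero,
    pow_one]
  simp only [Fin.sum_univ_four, Fin.prod_univ_four, Matrix.of_apply, Matrix.cons_val',
    Matrix.cons_val_zero, Matrix.cons_val_one, Matrix.cons_val_two, Matrix.cons_val_three,
    Matrix.empty_val', Matrix.cons_val_fin_one, Matrix.head_cons, Matrix.tail_cons,
    Matrix.head_fin_const, Fin.isValue,
    show ((1 : Fin 4) = 0) = False by decide, show ((2 : Fin 4) = 0) = False by decide,
    show ((3 : Fin 4) = 0) = False by decide, show ((0 : Fin 4) = 1) = False by decide,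
    show ((2 : Fin 4) = 1) = False by decide, show ((3 : Fin 4) = 1) = False by decide,
    show ((0 : Fin 4) = 2) = False by decide, show ((1 : Fin 4) = 2) = False by decide,
    show ((3 : Fin 4) = 2) = False by decide, show ((0 : Fin 4) = 3) = False by decide,
    show ((1 : Fin 4) = 3) = False by decide, show ((2 : Fin 4) = 3) = False by decide,
    if_true, if_false]
  ring

/-! ### `per_4 (u + s y)` for `u` supported on rows `2, 3` -/

/-- **`per_4 (u + s y)` for `u` supported on the eight cells of rows `2, 3`** (`u_{2j} = v_j`,
`u_{3j} = w_j`): no constant or linear term in `s`, and the `s²`-coefficient is the row pairing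
`Σ_{j<l} P_{jl}(y) (v_j w_l + v_l w_j)` through the six `2 × 2` subpermanents of rows `0, 1` of
`y` on the complementary columns. [folklore] -/
theorem eval_perPoly_rowsTwoThree_add_smul (v w : Fin 4 → K) (y : Fin 4 × Fin 4 → K) :
    ∃ c₃ c₄ : K, ∀ s : K,
      eval ((fun p : Fin 4 × Fin 4 => if p.1 = 2 then v p.2 else if p.1 = 3 then w p.2 else 0) +
          s • y) (perPoly (Fin 4) K) =
        s ^ 2 * ((y (0, 2) * y (1, 3) + y (0, 3) * y (1, 2)) * (v 0 * w 1 + v 1 * w 0) +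
                 (y (0, 1) * y (1, 3) + y (0, 3) * y (1, 1)) * (v 0 * w 2 + v 2 * w 0) +
                 (y (0, 1) * y (1, 2) + y (0, 2) * y (1, 1)) * (v 0 * w 3 + v 3 * w 0) +
                 (y (0, 0) * y (1, 3) + y (0, 3) * y (1, 0)) * (v 1 * w 2 + v 2 * w 1) +
                 (y (0, 0) * y (1, 2) + y (0, 2) * y (1, 0)) * (v 1 * w 3 + v 3 * w 1) +
                 (y (0, 0) * y (1, 1) + y (0, 1) * y (1, 0)) * (v 2 * w 3 + v 3 * w 2)) +
          s ^ 3 * c₃ + s ^ 4 * c₄ := by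
  obtain ⟨e20, e21, e22, e30, e31, e32⟩ := (succAbove_fin_four : _ ∧ _)
  obtain ⟨e00, e01, e02, e10, e11, e12⟩ := (succAbove_fin_four_zero_one : _ ∧ _)
  refine ⟨∑ j : Fin 4, v j * ((Matrix.of fun i j => y (i, j)).submatrix (2 : Fin 4).succAbove
        j.succAbove).permanent +
      ∑ j : Fin 4, w j * ((Matrix.of fun i j => y (i, j)).submatrix (3 : Fin 4).succAbove
        j.succAbove).permanent,
    (Matrix.of fun i j => y (i, j)).permanent, fun s => ?_⟩
  rw [eval_perPoly, Matrix.permanent_fin_four_row, Matrix.permanent_fin_four_row]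
  simp only [Fin.sum_univ_four, Matrix.permanent_fin_three_row]
  simp only [Matrix.of_apply, Matrix.submatrix_apply, Pi.add_apply, Pi.smul_apply, smul_eq_mul,
    e20, e21, e22, e30, e31, e32, e00, e01, e02, e10, e11, e12]
  simp only [show ((0 : Fin 4) = 2) = False by decide, show ((1 : Fin 4) = 2) = False by decide,
    show ((3 : Fin 4) = 2) = False by decide, show ((0 : Fin 4) = 3) = False by decide,
    show ((1 : Fin 4) = 3) = False by decide, show ((2 : Fin 4) = 3) = False by decide,
    if_false, if_true, zero_add]
  ring

/-! ### Rank `≤ 7` forces the pairing discriminant to vanish -/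

/-- **The swapped hypothesis at `y` with `|ι| < 8` squares forces `A·B = 4 Π` for rows `0, 1`**
(`A, B, Π` as in `det_pairing_eq` with `α = y_0`, `β = y_1`): the eight-variable row pairing is
a sum of `< 8` squares of linear forms, hence degenerate, so `P(y)` has a kernel vector and
`det P(y) = 0`. [folklore] -/
theorem pairingDisc_eq_of_sum_sq_swap_rows01 [CharZero K] {ι : Type*} [Fintype ι]
    (hι : Fintype.card ι < 8) (y : Fin 4 × Fin 4 → K) (c : ι → K)
    (Λ : ι → ((Fin 4 × Fin 4 → K) →ₗ[K] K))
    (h : ∀ u : Fin 4 × Fin 4 → K, ∃ e₀ e₁ : K, ∀ s : K,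
      eval (u + s • y) (perPoly (Fin 4) K) = e₀ + s * e₁ + s ^ 2 * ∑ k, c k * (Λ k u) ^ 2) :
    (∑ j, ∏ i, if i = j then y (0, i) else y (1, i)) *
        (∑ j, ∏ i, if i = j then y (1, i) else y (0, i)) = 4 * ∏ i, y (0, i) * y (1, i) := by
  classical
  -- the six subpermanents of rows `0, 1` (indexed by the complementary column pair)
  set P01 := y (0, 2) * y (1, 3) + y (0, 3) * y (1, 2) with hP01
  set P02 := y (0, 1) * y (1, 3) + y (0, 3) * y (1, 1) with hP02
  set P03 := y (0, 1) * y (1, 2) + y (0, 2) * y (1, 1) with hP03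
  set P12 := y (0, 0) * y (1, 3) + y (0, 3) * y (1, 0) with hP12
  set P13 := y (0, 0) * y (1, 2) + y (0, 2) * y (1, 0) with hP13
  set P23 := y (0, 0) * y (1, 1) + y (0, 1) * y (1, 0) with hP23
  -- the eight-parameter family of base points, linear in `(v, w)`
  let U : (Fin 4 → K) × (Fin 4 → K) →ₗ[K] (Fin 4 × Fin 4 → K) :=
    { toFun := fun vw p => if p.1 = 2 then vw.1 p.2 else if p.1 = 3 then vw.2 p.2 else 0
      map_add' := fun a b => by
        ext p
        simp only [Prod.fst_add, Prod.snd_add, Pi.add_apply]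
        split_ifs <;> simp
      map_smul' := fun a vw => by
        ext p
        simp only [Prod.smul_fst, Prod.smul_snd, Pi.smul_apply, smul_eq_mul, RingHom.id_apply]
        split_ifs <;> simp }
  have hU : ∀ v w : Fin 4 → K, U (v, w) =
      fun p => if p.1 = 2 then v p.2 else if p.1 = 3 then w p.2 else 0 := fun v w => rfl
  -- the `s²`-coefficient along the family is the pairing `F`
  set F : (Fin 4 → K) → (Fin 4 → K) → K := fun v w =>
    P01 * (v 0 * w 1 + v 1 * w 0) + P02 * (v 0 * w 2 + v 2 * w 0) +
      P03 * (v 0 * w 3 + v 3 * w 0) + P12 * (v 1 * w 2 + v 2 * w 1) +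
      P13 * (v 1 * w 3 + v 3 * w 1) + P23 * (v 2 * w 3 + v 3 * w 2) with hF
  have hS : ∀ v w : Fin 4 → K, ∑ k, c k * (Λ k (U (v, w))) ^ 2 = F v w := by
    intro v w
    obtain ⟨e₀, e₁, he⟩ := h (U (v, w))
    obtain ⟨c₃, c₄, hc⟩ := eval_perPoly_rowsTwoThree_add_smul v w y
    exact coeff_two_eq_of_forall fun s => by rw [← he s, hU, hc s]
  -- a common-kernel vector of the `Λ_k ∘ U` (eight parameters, fewer than eight functionals)
  let M : (Fin 4 → K) × (Fin 4 → K) →ₗ[K] (ι → K) := LinearMap.pi fun k => (Λ k).comp U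
  have hM : ∀ vw k, M vw k = Λ k (U vw) := fun vw k => rfl
  have hker : LinearMap.ker M ≠ ⊥ := LinearMap.ker_ne_bot_of_finrank_lt (by
    rw [Module.finrank_fintype_fun_eq_card, Module.finrank_prod,
      Module.finrank_fintype_fun_eq_card, Fintype.card_fin]
    omega)
  obtain ⟨n, hn, hn0⟩ := Submodule.exists_mem_ne_zero_of_ne_bot hker
  have hΛ0 : ∀ k, Λ k (U n) = 0 := fun k => by
    have := congr_fun (LinearMap.mem_ker.1 hn) k
    rwa [hM] at this
  -- translation invariance of `F` by `n = (v⁰, w⁰)`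
  have hinv : ∀ v w : Fin 4 → K, F (n.1 + v) (n.2 + w) = F v w := by
    intro v w
    have h1 := hS (n.1 + v) (n.2 + w)
    have hadd : ((n.1 + v, n.2 + w) : (Fin 4 → K) × (Fin 4 → K)) = n + (v, w) := rfl
    rw [hadd, map_add] at h1
    simp only [map_add, hΛ0, zero_add] at h1
    rw [hS v w] at h1
    exact h1.symm
  -- the matrix `P` and its kernel vector
  let P : Matrix (Fin 4) (Fin 4) K :=
    Matrix.of ![![0, P01, P02, P03], ![P01, 0, P12, P13], ![P02, P12, 0, P23],
      ![P03, P13, P23, 0]]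
  have hPv : ∀ z : Fin 4 → K,
      (P *ᵥ z) 0 = P01 * z 1 + P02 * z 2 + P03 * z 3 ∧
      (P *ᵥ z) 1 = P01 * z 0 + P12 * z 2 + P13 * z 3 ∧
      (P *ᵥ z) 2 = P02 * z 0 + P12 * z 1 + P23 * z 3 ∧
      (P *ᵥ z) 3 = P03 * z 0 + P13 * z 1 + P23 * z 2 := fun z =>
    ⟨by simp [P, Matrix.mulVec, dotProduct, Fin.sum_univ_four],
     by simp [P, Matrix.mulVec, dotProduct, Fin.sum_univ_four],
     by simp [P, Matrix.mulVec, dotProduct, Fin.sum_univ_four],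
     by simp [P, Matrix.mulVec, dotProduct, Fin.sum_univ_four]⟩
  have E : ∀ v w : Fin 4 → K, F n.1 w + F v n.2 + F n.1 n.2 = 0 := by
    intro v w
    have := hinv v w
    simp only [hF, Pi.add_apply] at this
    linear_combination this
  have hF0 : ∀ v, F v 0 = 0 := fun v => by simp [hF]
  have hF0' : ∀ w, F 0 w = 0 := fun w => by simp [hF]
  have E00 : F n.1 n.2 = 0 := by
    have := E 0 0
    rwa [hF0, hF0', zero_add, zero_add] at this
  have Ew : ∀ w, F n.1 w = 0 := fun w => by
    have := E 0 w
    rwa [hF0', E00, add_zero, add_zero] at this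
  have Ev : ∀ v, F v n.2 = 0 := fun v => by
    have := E v 0
    rwa [hF0, E00, zero_add, add_zero] at this
  have hsingle : ∀ (i j : Fin 4), (Pi.single i (1 : K) : Fin 4 → K) j = if j = i then 1 else 0 :=
    fun i j => by rw [Pi.single_apply]
  -- `P v⁰ = 0` and `P w⁰ = 0`: test the pairing against the unit vectors
  have hker1 : P *ᵥ n.1 = 0 := by
    obtain ⟨h0, h1, h2, h3⟩ := hPv n.1
    have g0 := Ew (Pi.single 0 1)
    have g1 := Ew (Pi.single 1 1)
    have g2 := Ew (Pi.single 2 1)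
    have g3 := Ew (Pi.single 3 1)
    simp only [hF, hsingle, Fin.isValue,
      show ((1 : Fin 4) = 0) = False by decide, show ((2 : Fin 4) = 0) = False by decide,
      show ((3 : Fin 4) = 0) = False by decide, show ((0 : Fin 4) = 1) = False by decide,
      show ((2 : Fin 4) = 1) = False by decide, show ((3 : Fin 4) = 1) = False by decide,
      show ((0 : Fin 4) = 2) = False by decide, show ((1 : Fin 4) = 2) = False by decide,
      show ((3 : Fin 4) = 2) = False by decide, show ((0 : Fin 4) = 3) = False by decide,
      show ((1 : Fin 4) = 3) = False by decide, show ((2 : Fin 4) = 3) = False by decide,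
      if_true, if_false, mul_one, mul_zero, add_zero, zero_add] at g0 g1 g2 g3
    ext i
    fin_cases i
    · show (P *ᵥ n.1) 0 = 0
      rw [h0]; linear_combination g0
    · show (P *ᵥ n.1) 1 = 0
      rw [h1]; linear_combination g1
    · show (P *ᵥ n.1) 2 = 0
      rw [h2]; linear_combination g2
    · show (P *ᵥ n.1) 3 = 0
      rw [h3]; linear_combination g3
  have hker2 : P *ᵥ n.2 = 0 := by
    obtain ⟨h0, h1, h2, h3⟩ := hPv n.2
    have g0 := Ev (Pi.single 0 1)
    have g1 := Ev (Pi.single 1 1)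
    have g2 := Ev (Pi.single 2 1)
    have g3 := Ev (Pi.single 3 1)
    simp only [hF, hsingle, Fin.isValue,
      show ((1 : Fin 4) = 0) = False by decide, show ((2 : Fin 4) = 0) = False by decide,
      show ((3 : Fin 4) = 0) = False by decide, show ((0 : Fin 4) = 1) = False by decide,
      show ((2 : Fin 4) = 1) = False by decide, show ((3 : Fin 4) = 1) = False by decide,
      show ((0 : Fin 4) = 2) = False by decide, show ((1 : Fin 4) = 2) = False by decide,
      show ((3 : Fin 4) = 2) = False by decide, show ((0 : Fin 4) = 3) = False by decide,
      show ((1 : Fin 4) = 3) = False by decide, show ((2 : Fin 4) = 3) = False by decide,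
      if_true, if_false, mul_zero, one_mul, zero_mul, add_zero, zero_add] at g0 g1 g2 g3
    ext i
    fin_cases i
    · show (P *ᵥ n.2) 0 = 0
      rw [h0]; linear_combination g0
    · show (P *ᵥ n.2) 1 = 0
      rw [h1]; linear_combination g1
    · show (P *ᵥ n.2) 2 = 0
      rw [h2]; linear_combination g2
    · show (P *ᵥ n.2) 3 = 0
      rw [h3]; linear_combination g3
  -- a non-zero kernel vector, hence `det P = 0`
  have hz : ∃ z : Fin 4 → K, z ≠ 0 ∧ P *ᵥ z = 0 := by
    by_cases h1 : n.1 = 0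
    · refine ⟨n.2, fun h2 => hn0 ?_, hker2⟩
      exact Prod.ext h1 h2
    · exact ⟨n.1, h1, hker1⟩
  have hdet : P.det = 0 := (Matrix.exists_mulVec_eq_zero_iff (M := P)).1 hz
  have hformula := det_pairing_eq (fun j => y (0, j)) (fun j => y (1, j))
  have hPdet : P.det = -4 * ((∑ j, ∏ i, if i = j then y (0, i) else y (1, i)) *
      (∑ j, ∏ i, if i = j then y (1, i) else y (0, i)) - 4 * ∏ i, y (0, i) * y (1, i)) := by
    rw [← hformula]
  rw [hPdet] at hdet
  have h4 : (-4 : K) ≠ 0 := by norm_num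
  have := (mul_eq_zero.1 hdet).resolve_left h4
  exact sub_eq_zero.1 this

/-- **General rows.**  Under the swapped hypothesis at `y` with `|ι| < 8` squares, for rows
`p ≠ q` the pairing discriminant of rows `p, q` vanishes: `A·B = 4 Π` with
`A = Σ_j y_{pj} Π_{i≠j} y_{qi}`, `B = Σ_j y_{qj} Π_{i≠j} y_{pi}`, `Π = Π_i y_{pi} y_{qi}`. [folklore] -/
theorem pairingDisc_eq_of_sum_sq_swap [CharZero K] {ι : Type*} [Fintype ι]
    (hι : Fintype.card ι < 8) (y : Fin 4 × Fin 4 → K)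
    (h : ∃ (c : ι → K) (Λ : ι → ((Fin 4 × Fin 4 → K) →ₗ[K] K)),
      ∀ u : Fin 4 × Fin 4 → K, ∃ e₀ e₁ : K, ∀ s : K,
        eval (u + s • y) (perPoly (Fin 4) K) = e₀ + s * e₁ + s ^ 2 * ∑ k, c k * (Λ k u) ^ 2)
    {p q : Fin 4} (hpq : p ≠ q) :
    (∑ j, ∏ i, if i = j then y (p, i) else y (q, i)) *
        (∑ j, ∏ i, if i = j then y (q, i) else y (p, i)) = 4 * ∏ i, y (p, i) * y (q, i) := by
  obtain ⟨c, Λ, hcΛ⟩ := h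
  obtain ⟨σ, hσ0, hσ1⟩ := exists_perm_zero_one p q hpq
  set e := Equiv.prodCongr σ (1 : Equiv.Perm (Fin 4)) with he
  -- the transported matrix `y' = y ∘ e` satisfies the swapped hypothesis with `Λ_k ∘ (· ∘ e⁻¹)`
  have h' : ∀ u : Fin 4 × Fin 4 → K, ∃ e₀ e₁ : K, ∀ s : K,
      eval (u + s • (y ∘ e)) (perPoly (Fin 4) K) =
        e₀ + s * e₁ + s ^ 2 * ∑ k, c k * ((Λ k).comp (LinearMap.funLeft K K e.symm) u) ^ 2 := by
    intro u
    obtain ⟨e₀, e₁, hu⟩ := hcΛ (u ∘ e.symm)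
    refine ⟨e₀, e₁, fun s => ?_⟩
    have hcomp : u + s • (y ∘ e) = (u ∘ e.symm + s • y) ∘ e := by
      ext x
      simp
    rw [hcomp, he, eval_perPoly_comp_prodCongr, ← he, hu s]
    rfl
  have h2 := pairingDisc_eq_of_sum_sq_swap_rows01 hι (y ∘ e) c
    (fun k => (Λ k).comp (LinearMap.funLeft K K e.symm)) h'
  simp only [Function.comp_apply, he, Equiv.prodCongr_apply, Prod.map_apply, hσ0, hσ1,
    Equiv.Perm.coe_one, id_eq] at h2
  exact h2

end Summit.ValiantsHypothesis.ValiantsHypothesis.Theorems.SymPencilPerFourRowPairing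

end
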